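import Literature.Probability.RandomPlanarGeometry.SLERestrictionIncrementKappa
import Literature.Probability.RandomPlanarGeometry.SLERestrictionBoundary
import HarnessLib

/-!
# The boundary cell of the localised compensated restriction martingale ([LSW] Prop. 5.3, `0 < κ ≤ 8/3`)

General-`κ` twin of `SLERestrictionBoundary` (the case `κ = 8/3`, `α = 5/8`, `λ = 0`), after
G. F. Lawler, O. Schramm, W. Werner, *Conformal restriction: the chordal case* (2003) (**[LSW]**),
§5 Prop. 5.3: the martingale `Y_t = h_t′(W_t)^α exp(λ ∫₀ᵗ Sh_s(W_s)/6 ds)`, `t < T`.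

The localised process is `Ỹ_t = (D̂ⁿ⁺¹_t)^α e^{−λ Iⁿ_t}` with the stopped compensator
`Iⁿ_t = ∫₀ᵗ 𝟙{s ≤ Tₙ} m(A_s − W_s) ds` (`IpnK`, `SLERestrictionCompensatorKappa`), stopped at the
localising time `Tₙ` (`locTimeK`). For the martingale property by conditional increments
(`SLERestrictionLocalMartingaleKappa`) one needs, besides the conditional one-step estimate of
`SLERestrictionIncrementKappa`, a pathwise bound on the **boundary cell** `u < Tₙ < u + h`:

* `abs_rpow_sub_rpow_le_powErr` — `|x^α − y^α| ≤ powErr α |x − y|` on `[0, 1]`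
  (`powErr α r = max α 1 · r^{min α 1}`: subadditivity for `α ≤ 1`, Bernoulli for `α ≥ 1`);
* `controlled_of_le_locTimeK` — the controlled class up to and including `Tₙ`;
* `abs_starDeriv_add_sub_leK` — one-step control from a base time `u < Tₙ` over the whole cell when
  the driver oscillates by at most `S`: alive, `|Φ′_{u+u′} − Φ′_u| ≤ cellErr n S h`, and
  `0 ≤ m_{u+u′} ≤ massBdCell n` (`StarHullSubStep`);
* `IpnK_add_eq` — additivity of the stopped compensator over a cell, and its increment as the
  integral of the shifted mass; `abs_JFnK_sub_le` — on the boundary cell the full increment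
  `∫ᵤ^{u+h} m` exceeds the stopped one `Iⁿ_{Tₙ} − Iⁿ_u` by at most `h · massBdCell n`;
* **`abs_stoppedK_sub_le`** — the boundary-cell estimate
  `|Ỹ_{(u+h) ∧ Tₙ} − e^{−λ Iⁿ_u} D̂_{u+h}^α e^{−λ ∫ᵤ^{u+h} m}| ≤ powErr α (2 cellErr n S h) + λ h massBdCell n`
  on `{u < Tₙ}` (and `= 0` when `Tₙ ≥ u + h`).

## References

* [LSW] Prop. 5.3 (§5). [LawlerSchrammWerner2003Restriction]
-/

noncomputable section

open Set Filter Metric Function MeasureTheory ProbabilityTheory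
open _root_.Complex _root_.Topology
open Literature.Probability.Process (brownian preWienerMeasure runSup)
open Literature.Analysis.FunctionSpaces (timeIntegral trunc)
open scoped NNReal

namespace Literature.Probability.RandomPlanarGeometry

open Loewner PathOps

/-! ### Power inequalities on `[0, 1]` -/

/-- `|x^α − y^α| ≤ |x − y|^α` for `x, y ≥ 0` and `0 < α ≤ 1` (subadditivity of `t ↦ t^α`). [folklore] -/
theorem abs_rpow_sub_rpow_le_of_le_one {α x y : ℝ} (hα0 : 0 ≤ α) (hα1 : α ≤ 1) (hx : 0 ≤ x) (hy : 0 ≤ y) :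
    |x ^ α - y ^ α| ≤ |x - y| ^ α := by
  wlog hxy : y ≤ x generalizing x y
  · have := this hy hx (le_of_not_ge hxy)
    rwa [abs_sub_comm, abs_sub_comm y x] at this
  have hsub : x ^ α ≤ (x - y) ^ α + y ^ α := by
    have h := NNReal.rpow_add_le_add_rpow (x - y).toNNReal y.toNNReal hα0 hα1
    have h' := NNReal.coe_le_coe.2 h
    rw [NNReal.coe_rpow, NNReal.coe_add, NNReal.coe_add, NNReal.coe_rpow, NNReal.coe_rpow,
      Real.coe_toNNReal _ (sub_nonneg.2 hxy), Real.coe_toNNReal _ hy, sub_add_cancel] at h'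
    exact h'
  have hmono : y ^ α ≤ x ^ α := Real.rpow_le_rpow hy hxy hα0
  rw [abs_of_nonneg (sub_nonneg.2 hmono), abs_of_nonneg (sub_nonneg.2 hxy)]
  linarith

/-- `|x^α − y^α| ≤ α |x − y|` for `x, y ∈ [0, 1]` and `1 ≤ α` (Bernoulli's inequality). [folklore] -/
theorem abs_rpow_sub_rpow_le_of_one_le {α x y : ℝ} (hα1 : 1 ≤ α) (hx : x ∈ Icc (0 : ℝ) 1) (hy : y ∈ Icc (0 : ℝ) 1) :
    |x ^ α - y ^ α| ≤ α * |x - y| := by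
  have hα0 : 0 ≤ α := by linarith
  wlog hxy : y ≤ x generalizing x y
  · have := this hy hx (le_of_not_ge hxy)
    rwa [abs_sub_comm, abs_sub_comm y x] at this
  have hmono : y ^ α ≤ x ^ α := Real.rpow_le_rpow hy.1 hxy hα0
  rw [abs_of_nonneg (sub_nonneg.2 hmono), abs_of_nonneg (sub_nonneg.2 hxy)]
  rcases hx.1.eq_or_lt with hx0 | hx0
  · -- `x = 0 = y`
    have hy0 : y = 0 := le_antisymm (hx0 ▸ hxy) hy.1
    rw [← hx0, hy0, Real.zero_rpow (by linarith)]; simp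
  · -- Bernoulli with `s = -(x - y)/x ≥ -1`: `(1 + s)^α ≥ 1 + α s`
    set s : ℝ := -((x - y) / x) with hs
    have hs1 : -1 ≤ s := by
      rw [hs, neg_le_neg_iff, div_le_one hx0]; linarith [hy.1]
    have hB := one_add_mul_self_le_rpow_one_add hs1 hα1
    have h1s : 1 + s = y / x := by rw [hs]; field_simp; ring
    rw [h1s, Real.div_rpow hy.1 hx.1] at hB
    -- `x^α (1 + α s) ≤ y^α`, i.e. `x^α - y^α ≤ α x^{α-1} (x - y) ≤ α (x - y)`
    have hxα : 0 < x ^ α := Real.rpow_pos_of_pos hx0 _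
    have h2 : x ^ α * (1 + α * s) ≤ y ^ α := by
      have := mul_le_mul_of_nonneg_left hB hxα.le
      rwa [mul_div_cancel₀ _ hxα.ne'] at this
    have h3 : x ^ α * (α * ((x - y) / x)) ≤ α * (x - y) := by
      have hx1 : x ^ α ≤ x := by
        have := Real.rpow_le_rpow_of_exponent_ge hx0 hx.2 hα1
        rwa [Real.rpow_one] at this
      have hxy0 : 0 ≤ x - y := sub_nonneg.2 hxy
      rw [show x ^ α * (α * ((x - y) / x)) = α * (x - y) * (x ^ α / x) by field_simp]
      have : x ^ α / x ≤ 1 := (div_le_one hx0).2 hx1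
      have h0 : 0 ≤ α * (x - y) := mul_nonneg hα0 hxy0
      nlinarith
    have : x ^ α * (1 + α * s) = x ^ α - x ^ α * (α * ((x - y) / x)) := by rw [hs]; ring
    linarith

/-- **The modulus of `t ↦ t^α` on `[0, 1]`**: `powErr α r = max α 1 · r^{min α 1}`. [folklore] -/
def powErr (α r : ℝ) : ℝ := max α 1 * r ^ min α 1

/-- `0 ≤ powErr α r` for `r ≥ 0`. [folklore] -/
theorem powErr_nonneg {α r : ℝ} (hr : 0 ≤ r) : 0 ≤ powErr α r :=
  mul_nonneg (le_max_of_le_right zero_le_one) (Real.rpow_nonneg hr _)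

/-- `powErr α` is monotone on `[0, ∞)` (for `α > 0`). [folklore] -/
theorem powErr_mono {α r r' : ℝ} (hα : 0 < α) (hr : 0 ≤ r) (hrr' : r ≤ r') : powErr α r ≤ powErr α r' :=
  mul_le_mul_of_nonneg_left (Real.rpow_le_rpow hr hrr' (le_min hα.le zero_le_one)) (le_max_of_le_right zero_le_one)

/-- **`|x^α − y^α| ≤ powErr α |x − y|` on `[0, 1]`** (`α > 0`). [folklore] -/
theorem abs_rpow_sub_rpow_le_powErr {α x y : ℝ} (hα : 0 < α) (hx : x ∈ Icc (0 : ℝ) 1) (hy : y ∈ Icc (0 : ℝ) 1) :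
    |x ^ α - y ^ α| ≤ powErr α |x - y| := by
  rw [powErr]
  rcases le_or_gt α 1 with hα1 | hα1
  · rw [max_eq_right hα1, min_eq_left hα1, one_mul]
    exact abs_rpow_sub_rpow_le_of_le_one hα.le hα1 hx.1 hy.1
  · rw [max_eq_left hα1.le, min_eq_right hα1.le, Real.rpow_one]
    exact abs_rpow_sub_rpow_le_of_one_le hα1.le hx hy

/-- `|ab − cd| ≤ |a − c| + |b − d|` for `b, c ∈ [0, 1]`. [folklore] -/
theorem abs_mul_sub_mul_le_of_mem_Icc {a b c d : ℝ} (hb : b ∈ Icc (0 : ℝ) 1) (hc : c ∈ Icc (0 : ℝ) 1) :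
    |a * b - c * d| ≤ |a - c| + |b - d| := by
  have h1 : a * b - c * d = (a - c) * b + c * (b - d) := by ring
  rw [h1]
  calc |(a - c) * b + c * (b - d)| ≤ |(a - c) * b| + |c * (b - d)| := abs_add_le _ _
    _ = |a - c| * b + c * |b - d| := by rw [abs_mul, abs_mul, abs_of_nonneg hb.1, abs_of_nonneg hc.1]
    _ ≤ |a - c| * 1 + 1 * |b - d| := add_le_add (mul_le_mul_of_nonneg_left hb.2 (abs_nonneg _))
        (mul_le_mul_of_nonneg_right hc.2 (abs_nonneg _))
    _ = |a - c| + |b - d| := by ring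

/-- `|e^{−a} − e^{−b}| ≤ |a − b|` for `a, b ≥ 0`. [folklore] -/
theorem abs_exp_neg_sub_exp_neg_le {a b : ℝ} (ha : 0 ≤ a) (hb : 0 ≤ b) :
    |Real.exp (-a) - Real.exp (-b)| ≤ |a - b| := by
  wlog hab : a ≤ b generalizing a b
  · have := this hb ha (le_of_not_ge hab)
    rwa [abs_sub_comm, abs_sub_comm b a] at this
  have hmono : Real.exp (-b) ≤ Real.exp (-a) := Real.exp_le_exp.2 (neg_le_neg hab)
  rw [abs_of_nonneg (sub_nonneg.2 hmono), abs_sub_comm, abs_of_nonneg (sub_nonneg.2 hab)]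
  -- `e^{-a} - e^{-b} = e^{-a} (1 - e^{-(b-a)}) ≤ 1 · (b - a)`
  have h1 : Real.exp (-a) - Real.exp (-b) = Real.exp (-a) * (1 - Real.exp (-(b - a))) := by
    rw [mul_sub, mul_one, ← Real.exp_add]; ring_nf
  rw [h1]
  have h2 : 1 - Real.exp (-(b - a)) ≤ b - a := by linarith [Real.add_one_le_exp (-(b - a))]
  have h3 : 0 ≤ 1 - Real.exp (-(b - a)) := by
    rw [sub_nonneg, Real.exp_le_one_iff]; linarith
  have h4 : Real.exp (-a) ≤ 1 := Real.exp_le_one_iff.2 (by linarith)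
  calc Real.exp (-a) * (1 - Real.exp (-(b - a))) ≤ 1 * (b - a) :=
        mul_le_mul h4 h2 h3 zero_le_one
    _ = b - a := one_mul _

/-! ### The controlled class up to and including `Tₙ` -/

section Controlled

variable {κ : ℝ≥0} {A : Set ℂ} {hA : IsStarHull A} {hne : A.Nonempty} {n : ℕ} {ω : ℝ≥0 → ℝ}

/-- **Up to and including `Tₙ > 0`** the path is alive, `R ≥ cₙ`, `D̂ⁿ⁺¹ = Φ' ≥ cₙ` and
`dist(0, A_t − W_t) ≥ cₙ` (the strict bounds before `Tₙ` pass to `Tₙ` by continuity). [folklore] -/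
theorem controlled_of_le_locTimeK {t : ℝ≥0} (ht : (t : WithTop ℝ≥0) ≤ locTimeK κ hA hne n ω)
    (hT0 : (0 : WithTop ℝ≥0) < locTimeK κ hA hne n ω) :
    Disjoint (closedHull (drvK κ (brownianCPath ω)) t) A ∧ locLevel n ≤ RpK κ hA hne t ω ∧
      DhatpK κ hA hne (n + 1) t ω = starDeriv (slidHull (drvK κ (brownianCPath ω)) A t) ∧
      locLevel n ≤ starDeriv (slidHull (drvK κ (brownianCPath ω)) A t) ∧
      locLevel n ≤ infDist 0 (slidHull (drvK κ (brownianCPath ω)) A t) := by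
  have hRD : locLevel n ≤ RpK κ hA hne t ω ∧ locLevel n ≤ DhatpK κ hA hne (n + 1) t ω := by
    rcases ht.lt_or_eq with hlt | heq
    · obtain ⟨-, hR, hDeq, hd, -⟩ := controlled_of_lt_locTimeK hlt
      exact ⟨hR.le, by rw [hDeq]; exact hd.le⟩
    · have ht0 : 0 < t := by
        have : (0 : WithTop ℝ≥0) < t := by rw [heq]; exact hT0
        exact_mod_cast this
      haveI : (𝓝[<] t).NeBot := nhdsLT_neBot_of_exists_lt ⟨0, ht0⟩
      have hev : ∀ᶠ r in 𝓝[<] t, locLevel n < RpK κ hA hne r ω ∧ locLevel n < DhatpK κ hA hne (n + 1) r ω := by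
        filter_upwards [self_mem_nhdsWithin] with r hr
        have hr' : (r : WithTop ℝ≥0) < locTimeK κ hA hne n ω := by rw [← heq]; exact_mod_cast hr
        obtain ⟨-, hR, hDeq, hd, -⟩ := controlled_of_lt_locTimeK hr'
        exact ⟨hR, by rw [hDeq]; exact hd⟩
      obtain ⟨hRc, hDc⟩ := continuous_RpK_DhatpK (κ := κ) (hA := hA) (hne := hne) (n + 1) ω
      constructor
      · exact ge_of_tendsto (hRc.continuousAt.tendsto.mono_left nhdsWithin_le_nhds) (hev.mono fun r hr ↦ hr.1.le)
      · exact ge_of_tendsto (hDc.continuousAt.tendsto.mono_left nhdsWithin_le_nhds) (hev.mono fun r hr ↦ hr.2.le)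
  obtain ⟨hR, hD⟩ := hRD
  have hR' : 1 / ((n + 1 : ℕ) : ℝ) ≤ RFnK κ hA hne t (brownianCPath ω) := by
    rw [Nat.cast_add, Nat.cast_one]; exact hR
  obtain ⟨halive, hDeq⟩ := DhatFnK_eq_starDeriv (κ := κ) (hA := hA) (hne := hne) (Nat.succ_pos n) hR'
  refine ⟨halive, hR, hDeq, by rw [← hDeq]; exact hD, ?_⟩
  have hsp := denseSeq_spec hA hne
  have := aliveFn_le_min_infDist (W := fun υ : C(ℝ≥0, ℝ) ↦ drvK κ υ) (continuous_drvK κ _) hA hsp.1 hsp.2 le_rfl halive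
  exact hR.trans (this.trans (min_le_left _ _))

end Controlled

/-! ### The pathwise cell estimates -/

/-- **The bound of the mass over a cell started in the controlled class**: `massBound (cₙ/2) (cₙ/16)`.
[folklore] -/
def massBdCell (n : ℕ) : ℝ := massBound (locLevel n / 2) (locLevel n / 16)

/-- `0 ≤ massBdCell n`. [folklore] -/
theorem massBdCell_nonneg (n : ℕ) : 0 ≤ massBdCell n := by
  have := (locLevel_pos_le n).1
  rw [massBdCell, massBound]; positivity

section Cell

variable {κ : ℝ≥0} {A : Set ℂ} {hA : IsStarHull A} {hne : A.Nonempty} {n : ℕ} {ω : ℝ≥0 → ℝ}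
  {u h : ℝ≥0} {S : ℝ}
  (hu : (u : WithTop ℝ≥0) < locTimeK κ hA hne n ω) (hh0 : 0 < h)
  (hS : ∀ r : ℝ≥0, r ≤ h → |drvK κ (brownianCPath ω) (u + r) - drvK κ (brownianCPath ω) u| ≤ S)
  (hsmall : stepSize S h ≤ locLevel n * (locLevel n / 16) / 1000)

include hu hS hsmall in
/-- **One-step control from the base time `u < Tₙ` over the whole cell**: for `0 < u' ≤ h`, the path is
alive at `u + u'`, `|Φ′_{A_{u+u′} − W_{u+u′}}(0) − Φ′_{A_u − W_u}(0)| ≤ cellErr n S h`, and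
`0 ≤ m(A_{u+u′} − W_{u+u′}) ≤ massBdCell n`. [folklore] -/
theorem abs_starDeriv_add_sub_leK {u' : ℝ≥0} (hu'0 : 0 < u') (hu'h : u' ≤ h) :
    Disjoint (closedHull (drvK κ (brownianCPath ω)) (u + u')) A ∧
      |starDeriv (slidHull (drvK κ (brownianCPath ω)) A (u + u')) - starDeriv (slidHull (drvK κ (brownianCPath ω)) A u)| ≤
        cellErr n S h ∧
      0 ≤ MpK κ A (u + u') ω ∧ MpK κ A (u + u') ω ≤ massBdCell n := by
  obtain ⟨hc0, hc1⟩ := locLevel_pos_le n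
  set c := locLevel n with hc
  set ρ₀ : ℝ := c / 16 with hρ
  have hρ₀ : 0 < ρ₀ := by positivity
  set W := drvK κ (brownianCPath ω) with hW
  have hWc : Continuous W := continuous_drvK κ _
  obtain ⟨halive, -, -, hd, hm⟩ := controlled_of_lt_locTimeK hu
  set B := slidHull W A u with hB
  have hBstar : IsStarHull B := Loewner.isStarHull_slidHull_of_disjoint hWc hA halive
  have hBρ16 : Disjoint (ball (0 : ℂ) (16 * ρ₀)) B := by
    rw [show 16 * ρ₀ = c by rw [hρ]; ring]
    exact disjoint_ball_infDist.mono_left (ball_subset_ball hm.le)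
  have hBρ : Disjoint (ball (0 : ℂ) (8 * ρ₀)) B := hBρ16.mono_left (ball_subset_ball (by linarith))
  -- the shifted driver
  set U : ℝ≥0 → ℝ := fun r ↦ W (u + r) - W u with hU
  have hUc : Continuous U := (continuous_shift W hWc u).sub continuous_const
  have hU0 : U 0 = 0 := by simp [hU]
  have hSU : ∀ v : ℝ≥0, v ≤ h → |U v| ≤ S := fun v hv ↦ hS v hv
  have hη : stepSize S h ≤ starDeriv B * ρ₀ / 1000 := by
    refine hsmall.trans ?_
    have := mul_le_mul_of_nonneg_right hd.le hρ₀.le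
    rw [div_le_div_iff_of_pos_right (by norm_num : (0:ℝ) < 1000)]
    exact this
  obtain ⟨hηρ2, hh4⟩ := subStep_smallness hBstar hSU hρ₀ hη
  -- survival data for the original flow from time `u` (radius `ρ₀`)
  have hstep_mono : stepSize S u' ≤ stepSize S h := stepSize_mono S hu'h
  have hη1 : stepSize S u' ≤ starDeriv B * ρ₀ / 1000 := hstep_mono.trans hη
  have hηρ : stepSize S u' ≤ ρ₀ := by
    refine hη1.trans ?_
    have hd1 := (starDeriv_pos_le_one B).2
    rw [div_le_iff₀ (by norm_num : (0:ℝ) < 1000)]; nlinarith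
  have hh4' : (u' : ℝ) ≤ (ρ₀ / 4) ^ 2 := by
    have h1 : (u' : ℝ) ≤ h := by exact_mod_cast hu'h
    have h2 : (h : ℝ) ≤ (2 * ρ₀ / 4) ^ 2 := hh4
    -- from `4√h ≤ stepSize S h ≤ ρ₀/1000`
    have hS0 : 0 ≤ S := by simpa [hU] using hSU 0 bot_le
    have h3 : stepSize S h ≤ ρ₀ / 1000 := hη.trans (by
      rw [div_le_div_iff_of_pos_right (by norm_num)]
      nlinarith [(starDeriv_pos_le_one B).2])
    rw [stepSize] at h3
    have hs := Real.sqrt_nonneg (h : ℝ)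
    have h4 : Real.sqrt h ≤ ρ₀ / 4000 := by linarith
    have h5 : (h : ℝ) = Real.sqrt h ^ 2 := (Real.sq_sqrt h.coe_nonneg).symm
    have h6 : Real.sqrt h ^ 2 ≤ (ρ₀ / 4000) ^ 2 := pow_le_pow_left₀ hs h4 2
    have h7 : (ρ₀ / 4000) ^ 2 ≤ (ρ₀ / 4) ^ 2 := by
      apply pow_le_pow_left₀ (by positivity)
      rw [div_le_div_iff₀ (by norm_num) (by norm_num)]; nlinarith
    linarith
  have hSu : ∀ r : ℝ≥0, r ≤ u' → |W (u + r) - W u| ≤ S := fun r hr ↦ hS r (hr.trans hu'h)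
  have haliveu' : Disjoint (closedHull W (u + u')) A := disjoint_closedHull_add hWc hA halive hρ₀ hBρ hu'0 hSu hηρ hh4'
  have hadd : slidHull W A (u + u') = slidHull U B u' := slidHull_add_eq hWc hA halive hρ₀ hBρ hu'0 hSu hηρ hh4'
  refine ⟨haliveu', ?_, ?_, ?_⟩
  · rw [hadd]
    have hS' : ∀ v : ℝ≥0, v ≤ u' → |U v| ≤ S := fun v hv ↦ hS v (hv.trans hu'h)
    have key := abs_starDeriv_slidHull_sub_le hBstar hUc hU0 hu'0 hS' hρ₀ hBρ hη1
    refine key.trans ?_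
    have hce : cellErr n S h = 50 * h / ρ₀ ^ 2 + 2 * stepSize S h / ρ₀ := by rw [cellErr]
    rw [hce]
    have h1 : 50 * (u' : ℝ) / ρ₀ ^ 2 ≤ 50 * h / ρ₀ ^ 2 := by gcongr
    have h2 : 2 * stepSize S u' / ρ₀ ≤ 2 * stepSize S h / ρ₀ := by gcongr
    linarith
  · exact MpK_nonneg hA _ ω
  · rw [MpK, MFnK_of_alive haliveu', hadd, massBdCell]
    have hδ : 2 * (locLevel n / 2) ≤ starDeriv B := by linarith
    exact (subStep_mass_bounds hBstar hUc hU0 hSU hρ₀ hBρ16 hη (by positivity) hδ hu'0 hu'h).2.1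

end Cell

/-! ### The stopped compensator over a cell -/

section Compensator

variable {κ : ℝ≥0} {A : Set ℂ} {hA : IsStarHull A} {hne : A.Nonempty} {n : ℕ}

/-- **Additivity of the stopped compensator over a cell**, the increment being the integral of the
shifted truncated mass. [folklore] -/
theorem IpnK_add_eq (u v : ℝ≥0) (ω : ℝ≥0 → ℝ) :
    IpnK κ hA hne n (u + v) ω = IpnK κ hA hne n u ω +
      ∫ r in (0 : ℝ)..v, trunc (locTimeK κ hA hne n) (MpK κ A) (u + r.toNNReal) ω := by
  set F : ℝ → ℝ := fun s ↦ trunc (locTimeK κ hA hne n) (MpK κ A) s.toNNReal ω with hF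
  have hint : ∀ a b : ℝ≥0, IntervalIntegrable F volume a b := by
    intro a b
    have h1 : IntegrableOn F (Icc (0 : ℝ) (max a b)) := by
      have := integrableOn_trunc_MpK (κ := κ) (hA := hA) (hne := hne) n ω (max a b)
      simpa using this
    refine (h1.mono_set ?_).intervalIntegrable
    intro s hs
    rw [Set.uIcc_comm, Set.mem_uIcc] at hs
    rcases hs with hs | hs
    · exact ⟨b.coe_nonneg.trans hs.1, hs.2.trans (by exact_mod_cast le_max_left a b)⟩
    · exact ⟨a.coe_nonneg.trans hs.1, hs.2.trans (by exact_mod_cast le_max_right a b)⟩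
  have hsplit : ∫ s in (0 : ℝ)..(u + v : ℝ≥0), F s = (∫ s in (0 : ℝ)..u, F s) + ∫ s in (u : ℝ)..(u + v : ℝ≥0), F s := by
    have := intervalIntegral.integral_add_adjacent_intervals (hint 0 u) (hint u (u + v))
    simpa using this.symm
  have hshift : ∫ s in (u : ℝ)..(u + v : ℝ≥0), F s = ∫ r in (0 : ℝ)..v, F (r + u) := by
    rw [intervalIntegral.integral_comp_add_right F (u : ℝ)]
    simp [add_comm]
  have hcongr : ∫ r in (0 : ℝ)..v, F (r + u) =
      ∫ r in (0 : ℝ)..v, trunc (locTimeK κ hA hne n) (MpK κ A) (u + r.toNNReal) ω := by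
    refine intervalIntegral.integral_congr fun r hr ↦ ?_
    rw [Set.uIcc_of_le v.coe_nonneg] at hr
    simp only [hF]
    congr 1
    rw [Real.toNNReal_add hr.1 u.coe_nonneg, Real.toNNReal_coe, add_comm]
  show ∫ s in (0 : ℝ)..(u + v : ℝ≥0), F s = (∫ s in (0 : ℝ)..u, F s) + _
  rw [hsplit, hshift, hcongr]

/-- **Before `Tₙ` the increment of the stopped compensator is the full increment `∫ᵤ^{u+v} m`.**
[folklore] -/
theorem integral_trunc_shift_eq_JFnK {u v : ℝ≥0} {ω : ℝ≥0 → ℝ}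
    (hle : ((u + v : ℝ≥0) : WithTop ℝ≥0) ≤ locTimeK κ hA hne n ω) :
    ∫ r in (0 : ℝ)..v, trunc (locTimeK κ hA hne n) (MpK κ A) (u + r.toNNReal) ω = JFnK κ A u v (brownianCPath ω) := by
  rw [JFnK_eq]
  refine intervalIntegral.integral_congr fun r hr ↦ ?_
  rw [Set.uIcc_of_le v.coe_nonneg] at hr
  have hrv : r.toNNReal ≤ v := Real.toNNReal_le_iff_le_coe.2 hr.2
  have hle' : ((u + r.toNNReal : ℝ≥0) : WithTop ℝ≥0) ≤ locTimeK κ hA hne n ω :=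
    (WithTop.coe_le_coe.2 (add_le_add le_rfl hrv)).trans hle
  simp only [Literature.Analysis.FunctionSpaces.trunc_apply, if_pos hle', MpK]

/-- **Before `Tₙ` the stopped compensator splits as `Iⁿ_{u+v} = Iⁿ_u + ∫ᵤ^{u+v} m`.** [folklore] -/
theorem IpnK_add_eq_JFnK {u v : ℝ≥0} {ω : ℝ≥0 → ℝ} (hle : ((u + v : ℝ≥0) : WithTop ℝ≥0) ≤ locTimeK κ hA hne n ω) :
    IpnK κ hA hne n (u + v) ω = IpnK κ hA hne n u ω + JFnK κ A u v (brownianCPath ω) := by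
  rw [IpnK_add_eq, integral_trunc_shift_eq_JFnK hle]

end Compensator

/-! ### The boundary-cell estimate -/

section Boundary

variable {κ : ℝ≥0} {A : Set ℂ} {hA : IsStarHull A} {hne : A.Nonempty} {n : ℕ} {ω : ℝ≥0 → ℝ}
  {u h : ℝ≥0} {S : ℝ}
  (hu : (u : WithTop ℝ≥0) < locTimeK κ hA hne n ω) (hh0 : 0 < h)
  (hS : ∀ r : ℝ≥0, r ≤ h → |drvK κ (brownianCPath ω) (u + r) - drvK κ (brownianCPath ω) u| ≤ S)
  (hsmall : stepSize S h ≤ locLevel n * (locLevel n / 16) / 1000)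

include hu hS hsmall in
/-- **The full increment exceeds a shorter one by at most `h · massBdCell n`**: for `v ≤ h`,
`0 ≤ ∫ᵤ^{u+h} m − ∫ᵤ^{u+v} m ≤ h · massBdCell n` (off the oscillation event). [folklore] -/
theorem JFnK_sub_JFnK_mem {v : ℝ≥0} (hv : v ≤ h) :
    0 ≤ JFnK κ A u h (brownianCPath ω) - JFnK κ A u v (brownianCPath ω) ∧
      JFnK κ A u h (brownianCPath ω) - JFnK κ A u v (brownianCPath ω) ≤ h * massBdCell n := by
  letI : MeasurableSpace C(ℝ≥0, ℝ) := borel _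
  haveI : BorelSpace C(ℝ≥0, ℝ) := ⟨rfl⟩
  set G : ℝ → ℝ := fun r ↦ MFnK κ A (u + r.toNNReal) (brownianCPath ω) with hG
  have hGm : Measurable G := (measurable_MFnK_shift_path hA hne u (brownianCPath ω)).comp measurable_real_toNNReal
  have hGb : ∀ r ∈ Ioc (0 : ℝ) h, 0 ≤ G r ∧ G r ≤ massBdCell n := fun r hr ↦ by
    have hr0 : 0 < r.toNNReal := Real.toNNReal_pos.2 hr.1
    have hrh : r.toNNReal ≤ h := Real.toNNReal_le_iff_le_coe.2 hr.2
    obtain ⟨-, -, h0, hM⟩ := abs_starDeriv_add_sub_leK hu hS hsmall hr0 hrh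
    exact ⟨h0, hM⟩
  have h1 : IntegrableOn G (Ioc (0 : ℝ) h) := by
    refine Measure.integrableOn_of_bounded (M := massBdCell n) measure_Ioc_lt_top.ne hGm.aestronglyMeasurable ?_
    filter_upwards [ae_restrict_mem measurableSet_Ioc] with r hr
    obtain ⟨h0, hM⟩ := hGb r hr
    rw [Real.norm_eq_abs, abs_of_nonneg h0]; exact hM
  have hint : ∀ a b : ℝ≥0, a ≤ b → b ≤ h → IntervalIntegrable G volume a b := fun a b hab hb ↦
    (intervalIntegrable_iff_integrableOn_Ioc_of_le (NNReal.coe_le_coe.2 hab)).2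
      (h1.mono_set (Ioc_subset_Ioc a.coe_nonneg (NNReal.coe_le_coe.2 hb)))
  have hsplit : JFnK κ A u h (brownianCPath ω) - JFnK κ A u v (brownianCPath ω) = ∫ r in (v : ℝ)..h, G r := by
    have := intervalIntegral.integral_add_adjacent_intervals (hint 0 v bot_le hv) (hint v h hv le_rfl)
    rw [NNReal.coe_zero] at this
    rw [JFnK_eq, JFnK_eq]
    show (∫ r in (0 : ℝ)..h, G r) - ∫ r in (0 : ℝ)..v, G r = ∫ r in (v : ℝ)..h, G r
    linarith
  rw [hsplit]
  constructor
  · exact intervalIntegral.integral_nonneg (NNReal.coe_le_coe.2 hv) fun r _ ↦ MFnK_nonneg hA _ _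
  · have hb : ∀ r ∈ Set.uIoc (v : ℝ) h, ‖G r‖ ≤ massBdCell n := fun r hr ↦ by
      rw [Set.uIoc_of_le (NNReal.coe_le_coe.2 hv)] at hr
      obtain ⟨h0, hM⟩ := hGb r ⟨v.coe_nonneg.trans_lt hr.1, hr.2⟩
      rw [Real.norm_eq_abs, abs_of_nonneg h0]; exact hM
    have := intervalIntegral.norm_integral_le_of_norm_le_const hb
    rw [Real.norm_eq_abs] at this
    have hhv : |(h : ℝ) - v| ≤ h := by
      rw [abs_of_nonneg (sub_nonneg.2 (NNReal.coe_le_coe.2 hv))]; linarith [v.coe_nonneg]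
    calc ∫ r in (v : ℝ)..h, G r ≤ |∫ r in (v : ℝ)..h, G r| := le_abs_self _
      _ ≤ massBdCell n * |(h : ℝ) - v| := this
      _ ≤ massBdCell n * h := mul_le_mul_of_nonneg_left hhv (massBdCell_nonneg n)
      _ = h * massBdCell n := mul_comm _ _

include hu hh0 hS hsmall in
/-- **The boundary-cell estimate** for `Ỹ_t = (D̂ⁿ⁺¹_t)^α e^{−λ Iⁿ_t}`: with `C_u = e^{−λ Iⁿ_u}` and
`Ŷ′_{u+h} = (Φ′ 𝟙{alive})_{u+h}^α e^{−λ ∫ᵤ^{u+h} m}`,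
`|Ỹ_{(u+h) ∧ Tₙ} − C_u Ŷ′_{u+h}| ≤ powErr α (2 cellErr n S h) + λ h · massBdCell n` (and `= 0` when
`Tₙ ≥ u + h`). [cite: LawlerSchrammWerner2003Restriction, §5 (Prop. 5.3)] -/
theorem abs_stoppedK_sub_le {α lam : ℝ} (hα : 0 < α) (hlam : 0 ≤ lam) :
    |stoppedProcess (fun t ω ↦ DhatpK κ hA hne (n + 1) t ω ^ α * Real.exp (-(lam * IpnK κ hA hne n t ω)))
          (locTimeK κ hA hne n) (u + h) ω -
        Real.exp (-(lam * IpnK κ hA hne n u ω)) *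
          (DFnK κ A (u + h) (brownianCPath ω) ^ α * Real.exp (-(lam * JFnK κ A u h (brownianCPath ω))))| ≤
      powErr α (2 * cellErr n S h) + lam * (h * massBdCell n) := by
  have hT0 : (0 : WithTop ℝ≥0) < locTimeK κ hA hne n ω := lt_of_le_of_lt bot_le hu
  obtain ⟨haliveh, hdh, -, -⟩ := abs_starDeriv_add_sub_leK hu hS hsmall hh0 le_rfl
  have hDFn : DFnK κ A (u + h) (brownianCPath ω) = starDeriv (slidHull (drvK κ (brownianCPath ω)) A (u + h)) :=
    (DFnK_eq (κ := κ) (A := A) (u + h) (brownianCPath ω)).1 haliveh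
  have hΔ0 : 0 ≤ cellErr n S h := (abs_nonneg _).trans hdh
  have hP0 : 0 ≤ powErr α (2 * cellErr n S h) := powErr_nonneg (by positivity)
  have hM0 : 0 ≤ lam * (h * massBdCell n) := mul_nonneg hlam (mul_nonneg h.coe_nonneg (massBdCell_nonneg n))
  set Iu := IpnK κ hA hne n u ω with hIu
  set Jh := JFnK κ A u h (brownianCPath ω) with hJh
  rw [stoppedProcess, hDFn]
  rcases le_or_gt ((u + h : ℝ≥0) : WithTop ℝ≥0) (locTimeK κ hA hne n ω) with hle | hlt
  · -- `Tₙ ≥ u + h`: no boundary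
    rw [min_eq_left hle, Process.untopA_coe]
    obtain ⟨-, -, hDeq, -, -⟩ := controlled_of_le_locTimeK hle hT0
    rw [hDeq, IpnK_add_eq_JFnK hle, mul_add, neg_add, Real.exp_add]
    have : starDeriv (slidHull (drvK κ (brownianCPath ω)) A (u + h)) ^ α * (Real.exp (-(lam * Iu)) * Real.exp (-(lam * Jh))) -
        Real.exp (-(lam * Iu)) * (starDeriv (slidHull (drvK κ (brownianCPath ω)) A (u + h)) ^ α * Real.exp (-(lam * Jh))) = 0 := by
      ring
    rw [this, abs_zero]; positivity
  · -- `u < Tₙ = τ < u + h`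
    obtain ⟨τ, hτ⟩ := WithTop.ne_top_iff_exists.1 (ne_top_of_lt hlt)
    have hτ' : locTimeK κ hA hne n ω = τ := hτ.symm
    have huτ : u < τ := by
      have : (u : WithTop ℝ≥0) < τ := by rw [hτ]; exact hu
      exact_mod_cast this
    have hτh : τ < u + h := by
      have : (τ : WithTop ℝ≥0) < (u + h : ℝ≥0) := by rw [hτ]; exact hlt
      exact_mod_cast this
    rw [hτ', min_eq_right (WithTop.coe_le_coe.2 hτh.le), Process.untopA_coe]
    obtain ⟨-, -, hDeq, -, -⟩ := controlled_of_le_locTimeK (κ := κ) (hA := hA) (hne := hne) (n := n) (ω := ω) (t := τ)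
      (by rw [hτ']) hT0
    rw [hDeq]
    -- `τ = u + v`, `v = τ - u ∈ (0, h)`
    set v : ℝ≥0 := τ - u with hv
    have hv0 : 0 < v := tsub_pos_of_lt huτ
    have hvh : v ≤ h := by rw [hv, tsub_le_iff_right, add_comm]; exact hτh.le
    have hτuv : τ = u + v := by rw [hv, add_tsub_cancel_of_le huτ.le]
    have hlev : ((u + v : ℝ≥0) : WithTop ℝ≥0) ≤ locTimeK κ hA hne n ω := by rw [← hτuv, hτ']
    rw [hτuv, IpnK_add_eq_JFnK hlev, mul_add, neg_add, Real.exp_add]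
    set Jv := JFnK κ A u v (brownianCPath ω) with hJv
    set dτ := starDeriv (slidHull (drvK κ (brownianCPath ω)) A (u + v)) with hdτ
    set dh := starDeriv (slidHull (drvK κ (brownianCPath ω)) A (u + h)) with hdh'
    -- factor out `C_u ∈ (0, 1]`
    have hCu0 : 0 < Real.exp (-(lam * Iu)) := Real.exp_pos _
    have hCu1 : Real.exp (-(lam * Iu)) ≤ 1 := by
      rw [Real.exp_le_one_iff, neg_nonpos]; exact mul_nonneg hlam (IpnK_nonneg n u ω)
    have hfac : dτ ^ α * (Real.exp (-(lam * Iu)) * Real.exp (-(lam * Jv))) - Real.exp (-(lam * Iu)) * (dh ^ α * Real.exp (-(lam * Jh))) =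
        Real.exp (-(lam * Iu)) * (dτ ^ α * Real.exp (-(lam * Jv)) - dh ^ α * Real.exp (-(lam * Jh))) := by ring
    rw [hfac, abs_mul, abs_of_pos hCu0]
    -- the two factors of each product lie in `[0, 1]`
    obtain ⟨hdτ0, hdτ1⟩ := starDeriv_pos_le_one (slidHull (drvK κ (brownianCPath ω)) A (u + v))
    obtain ⟨hdh0, hdh1⟩ := starDeriv_pos_le_one (slidHull (drvK κ (brownianCPath ω)) A (u + h))
    have hJv0 : 0 ≤ Jv := JFnK_nonneg hA u v _
    have hJh0 : 0 ≤ Jh := JFnK_nonneg hA u h _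
    have eI : ∀ {J : ℝ}, 0 ≤ J → Real.exp (-(lam * J)) ∈ Icc (0 : ℝ) 1 := fun hJ ↦
      ⟨(Real.exp_pos _).le, by rw [Real.exp_le_one_iff, neg_nonpos]; exact mul_nonneg hlam hJ⟩
    have hpτ : dτ ^ α ∈ Icc (0 : ℝ) 1 := ⟨Real.rpow_nonneg hdτ0.le _, Real.rpow_le_one hdτ0.le hdτ1 hα.le⟩
    have hph : dh ^ α ∈ Icc (0 : ℝ) 1 := ⟨Real.rpow_nonneg hdh0.le _, Real.rpow_le_one hdh0.le hdh1 hα.le⟩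
    have hsplit := abs_mul_sub_mul_le_of_mem_Icc (a := dτ ^ α) (d := Real.exp (-(lam * Jh))) (eI hJv0) hph
    -- the power term
    have hpow : |dτ ^ α - dh ^ α| ≤ powErr α (2 * cellErr n S h) := by
      obtain ⟨-, hdv, -, -⟩ := abs_starDeriv_add_sub_leK hu hS hsmall hv0 hvh
      refine (abs_rpow_sub_rpow_le_powErr hα ⟨hdτ0.le, hdτ1⟩ ⟨hdh0.le, hdh1⟩).trans (powErr_mono hα (abs_nonneg _) ?_)
      rw [abs_sub_comm] at hdh
      calc |dτ - dh| ≤ |dτ - starDeriv (slidHull (drvK κ (brownianCPath ω)) A u)| +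
            |starDeriv (slidHull (drvK κ (brownianCPath ω)) A u) - dh| := abs_sub_le _ _ _
        _ ≤ cellErr n S h + cellErr n S h := add_le_add hdv hdh
        _ = 2 * cellErr n S h := by ring
    -- the compensator term
    have hexp : |Real.exp (-(lam * Jv)) - Real.exp (-(lam * Jh))| ≤ lam * (h * massBdCell n) := by
      refine (abs_exp_neg_sub_exp_neg_le (mul_nonneg hlam hJv0) (mul_nonneg hlam hJh0)).trans ?_
      obtain ⟨hge, hle⟩ := JFnK_sub_JFnK_mem hu hS hsmall hvh
      rw [← mul_sub, abs_mul, abs_of_nonneg hlam, abs_sub_comm, abs_of_nonneg hge]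
      exact mul_le_mul_of_nonneg_left hle hlam
    calc Real.exp (-(lam * Iu)) * |dτ ^ α * Real.exp (-(lam * Jv)) - dh ^ α * Real.exp (-(lam * Jh))|
        ≤ 1 * (powErr α (2 * cellErr n S h) + lam * (h * massBdCell n)) :=
          mul_le_mul hCu1 (hsplit.trans (add_le_add hpow hexp)) (abs_nonneg _) zero_le_one
      _ = _ := one_mul _

end Boundary

end Literature.Probability.RandomPlanarGeometry

end
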